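import Literature.RepresentationTheory.KonnoKonno2007.RealUnitaryRankOneKAKFibers
import Mathlib.Analysis.SpecialFunctions.Arsinh
import HarnessLib

/-!
# An explicit differentiable `KAK` section of `U(2,1)` off `K` — I: the section as matrix algebra

Topic `RepresentationTheory/KonnoKonno2007`; namespace `Literature.RepresentationTheory.KonnoKonno2007.RealDualPair` (sequel of ★
`RealUnitaryRankOneKAK` ∕ ★ `RealUnitaryRankOneKAKFibers`: `UForm α β = U(α,β)`, `kV : U(α) × U(β) →* U(α,β)`, `hypV p₀ q₀ t = a_t` with matrix
`plant p₀ q₀ [[cosh t, −i sinh t], [i sinh t, cosh t]]`, `kakMap (k₁, t, k₂) = k₁ a_t k₂`, `gauge`).  KERNEL ONLY: plumbing definitions with bodies and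
proved theorems; no structure, no instance, no notation, no named fact, no `sorry`.  Cell `hodgecm-mathlib`, F0∕P3, the in-house road to the letter A6
`HasUnitaryGlobalizationOfInfUnitary` at `U(2,1)` (ROAD-GLOB v1.1, brick «S1b»; sequels `U21KAKSectionGroup` (on `U(2,1)`), `U21KAKSectionDifferentiable`).

For `G = U(2,1) = UForm (Fin 2) (Fin 1)`, `K = U(2) × U(1)` and the boost `a_t = hypV 0 0 t` in the plane `(e₁, e₃)`, ★ `kakMap_surjective` says
`G = K A⁺ K`; the consumer (the globalization `Φ(k₁ a_t k₂) := ϖK(k₁) U(t) ϖK(k₂)` and its derivative along `s ↦ g a_s`, bricks Φ1–Φ2) needs a SECTION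
`g ↦ (k₁(g), t(g), k₂(g))` that is an honest DIFFERENTIABLE function of the matrix off `K`.  Writing the last row of `g` as `(r, c) = (g₃₁, g₃₂, g₃₃)`
(so `|c|² = 1 + ‖r‖²` on `G`), this file defines, as TOTAL functions of `M : Matrix (Fin 2 ⊕ Fin 1) (Fin 2 ⊕ Fin 1) ℂ`,

* `secT M = arsinh ‖r‖` (§2: `sinh (secT M) = ‖r‖`, `cosh (secT M) = √(1 + ‖r‖²)`, `0 < secT M ↔ ‖r‖ ≠ 0`),
* `secK₂ M = diag(U, c∕|c|)` with `U = secU M = [[−i r₁∕‖r‖, −i r₂∕‖r‖], [−r̄₂∕‖r‖, r̄₁∕‖r‖]]` — the phase `−i` on the first row is forced by the tree's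
  convention for `a_t` (so that the last row `(i‖r‖, 0, |c|)` of `M · k₂⁻¹` is killed by `a_{−secT M}`), its explicit inverse `secK₂Inv M = diag(Uᴴ, c̄∕|c|)`,
* `secK₁ M = M · secK₂Inv M · a_{−secT M}`, and its `U(2)`-block `secU₁ M`,

and proves: §3 `U ∈ U(2)` (`‖r‖ ≠ 0`), `c∕|c| ∈ U(1)` (`c ≠ 0`), `secK₂ · secK₂Inv = 1 = secK₂Inv · secK₂`; §4 the last row of `M · secK₂Inv M` is
`(i‖r‖, 0, |c|)`, hence — whenever `|c| = cosh (secT M)`, which is the case on `U(2,1)` — the last row of `secK₁ M` is `(0, 0, 1)`; and the pure-algebra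
SECTION IDENTITY **`secK₁_mul_hypV_mul_secK₂ : secK₁ M · ↑(a_{secT M}) · secK₂ M = M`** (`a_{−T} a_T = 1`, `k₂⁻¹ k₂ = 1`).  The group-theoretic
consequences (`k₁, k₂ ∈ K`, `kakMap 0 0 (k₁, secT g, k₂) = g`) are in `U21KAKSectionGroup`; differentiability in `U21KAKSectionDifferentiable`.

Provenance (statement shape only): the Cartan decomposition `G = K A⁺ K` with `A` one-dimensional for real rank one [Knapp2002, VII §3 Thm. 7.39],
[Helgason1978, Ch. IX Thm. 1.1]; the smooth section off `K` is the elementary normalisation of the last row.  Mathlib ∕ tree search: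
`rg "secK|KAKSection|arsinh" Literature/RepresentationTheory` — no prior section; ★ `exists_kV_mul_hypV_mul_kV_eq` (existence via a column argument) is the
non-constructive ancestor.

## References
* [Knapp2002] A. W. Knapp, *Lie Groups Beyond an Introduction*, 2nd ed. (2002), I §10 Prop. 1.87, VII §3 Thm. 7.39.
* [Helgason1978] S. Helgason, *Differential Geometry, Lie Groups, and Symmetric Spaces*, Ch. IX Thm. 1.1.
-/

set_option autoImplicit false

noncomputable section

open Matrix Complex Topology Filter
open scoped ComplexConjugate MatrixGroups
open NormedSpace

namespace Literature.RepresentationTheory.KonnoKonno2007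

namespace RealDualPair

open Literature.NumberTheory.Automorphic Literature.RepresentationTheory.BorelWallach2000

/-! ## §1 The section as total functions of the matrix -/

section Defs

/-- the norm `‖r‖ = (|g₃₁|² + |g₃₂|²)^{1/2}` of the off-corner part `r = (g₃₁, g₃₂)` of the last row. [cite: Knapp2002, VII §3 Thm. 7.39] -/
def rowNorm (M : Matrix (Fin 2 ⊕ Fin 1) (Fin 2 ⊕ Fin 1) ℂ) : ℝ :=
  Real.sqrt (‖M (Sum.inr 0) (Sum.inl 0)‖ ^ 2 + ‖M (Sum.inr 0) (Sum.inl 1)‖ ^ 2)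

/-- **the `A`-coordinate** `secT g = arsinh ‖r‖` (so that `sinh (secT g) = ‖r‖`, and `cosh (secT g) = |g₃₃|` on `U(2,1)`). [cite: Knapp2002, VII §3 Thm. 7.39] -/
def secT (M : Matrix (Fin 2 ⊕ Fin 1) (Fin 2 ⊕ Fin 1) ℂ) : ℝ := Real.arsinh (rowNorm M)

/-- **the `U(2)`-block of `k₂`**: rows `−i·r∕‖r‖` and `(−r̄₂, r̄₁)∕‖r‖` (the phase `−i` matches the tree's boost
`a_t = [[cosh t, −i sinh t], [i sinh t, cosh t]]`, ★ `coe_hypV`). [cite: Knapp2002, VII §3 Thm. 7.39] -/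
def secU (M : Matrix (Fin 2 ⊕ Fin 1) (Fin 2 ⊕ Fin 1) ℂ) : Matrix (Fin 2) (Fin 2) ℂ :=
  !![-I * M (Sum.inr 0) (Sum.inl 0) / (rowNorm M : ℂ), -I * M (Sum.inr 0) (Sum.inl 1) / (rowNorm M : ℂ);
     -conj (M (Sum.inr 0) (Sum.inl 1)) / (rowNorm M : ℂ), conj (M (Sum.inr 0) (Sum.inl 0)) / (rowNorm M : ℂ)]

/-- **the `U(1)`-block of `k₂`**: the phase `g₃₃ ∕ |g₃₃|`. [cite: Knapp2002, VII §3 Thm. 7.39] -/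
def secZ (M : Matrix (Fin 2 ⊕ Fin 1) (Fin 2 ⊕ Fin 1) ℂ) : Matrix (Fin 1) (Fin 1) ℂ :=
  !![M (Sum.inr 0) (Sum.inr 0) / (‖M (Sum.inr 0) (Sum.inr 0)‖ : ℂ)]

/-- **`k₂ = secK₂ g := diag(secU g, secZ g)`**. [cite: Knapp2002, VII §3 Thm. 7.39] -/
def secK₂ (M : Matrix (Fin 2 ⊕ Fin 1) (Fin 2 ⊕ Fin 1) ℂ) : Matrix (Fin 2 ⊕ Fin 1) (Fin 2 ⊕ Fin 1) ℂ :=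
  Matrix.fromBlocks (secU M) 0 0 (secZ M)

/-- the explicit inverse `k₂⁻¹ = diag((secU g)ᴴ, (secZ g)ᴴ)` (conjugate transposes of unitary blocks). [cite: Knapp2002, VII §3 Thm. 7.39] -/
def secK₂Inv (M : Matrix (Fin 2 ⊕ Fin 1) (Fin 2 ⊕ Fin 1) ℂ) : Matrix (Fin 2 ⊕ Fin 1) (Fin 2 ⊕ Fin 1) ℂ :=
  Matrix.fromBlocks (secU M)ᴴ 0 0 (secZ M)ᴴ

/-- **`k₁ = secK₁ g := g · k₂⁻¹ · a_{−secT g}`**. [cite: Knapp2002, VII §3 Thm. 7.39] -/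
def secK₁ (M : Matrix (Fin 2 ⊕ Fin 1) (Fin 2 ⊕ Fin 1) ℂ) : Matrix (Fin 2 ⊕ Fin 1) (Fin 2 ⊕ Fin 1) ℂ :=
  M * secK₂Inv M * (((hypV (0 : Fin 2) (0 : Fin 1) (-secT M) : UForm (Fin 2) (Fin 1)) : GL (Fin 2 ⊕ Fin 1) ℂ) :
    Matrix (Fin 2 ⊕ Fin 1) (Fin 2 ⊕ Fin 1) ℂ)

/-- the `U(2)`-block of `k₁` (its only non-trivial block on `U(2,1)`, where `k₁ = diag(secU₁ g, 1)`). [cite: Knapp2002, VII §3 Thm. 7.39] -/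
def secU₁ (M : Matrix (Fin 2 ⊕ Fin 1) (Fin 2 ⊕ Fin 1) ℂ) : Matrix (Fin 2) (Fin 2) ℂ :=
  Matrix.of fun a a' => secK₁ M (Sum.inl a) (Sum.inl a')

end Defs

/-! ## §2 Elementary facts on the coordinates -/

section Basic

variable (M : Matrix (Fin 2 ⊕ Fin 1) (Fin 2 ⊕ Fin 1) ℂ)

/-- `‖r‖ ≥ 0`. [cite: Knapp2002, VII §3 Thm. 7.39] -/
theorem rowNorm_nonneg : 0 ≤ rowNorm M := Real.sqrt_nonneg _

/-- `‖r‖² = |g₃₁|² + |g₃₂|²`. [cite: Knapp2002, VII §3 Thm. 7.39] -/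
theorem rowNorm_sq : rowNorm M ^ 2 = ‖M (Sum.inr 0) (Sum.inl 0)‖ ^ 2 + ‖M (Sum.inr 0) (Sum.inl 1)‖ ^ 2 :=
  Real.sq_sqrt (by positivity)

/-- `‖r‖ = 0 ↔ r = 0`. [cite: Knapp2002, VII §3 Thm. 7.39] -/
theorem rowNorm_eq_zero_iff : rowNorm M = 0 ↔ M (Sum.inr 0) (Sum.inl 0) = 0 ∧ M (Sum.inr 0) (Sum.inl 1) = 0 := by
  constructor
  · intro h
    have h2 := rowNorm_sq M
    rw [h] at h2
    have h0 : ‖M (Sum.inr 0) (Sum.inl 0)‖ ^ 2 = 0 := by nlinarith [sq_nonneg ‖M (Sum.inr 0) (Sum.inl 0)‖, sq_nonneg ‖M (Sum.inr 0) (Sum.inl 1)‖]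
    have h1 : ‖M (Sum.inr 0) (Sum.inl 1)‖ ^ 2 = 0 := by nlinarith [sq_nonneg ‖M (Sum.inr 0) (Sum.inl 0)‖, sq_nonneg ‖M (Sum.inr 0) (Sum.inl 1)‖]
    exact ⟨norm_eq_zero.1 (pow_eq_zero_iff two_ne_zero |>.1 h0), norm_eq_zero.1 (pow_eq_zero_iff two_ne_zero |>.1 h1)⟩
  · rintro ⟨h0, h1⟩
    rw [rowNorm, h0, h1, norm_zero]
    simp

/-- `‖r‖ = 0` iff every off-corner entry of the last row vanishes. [cite: Knapp2002, VII §3 Thm. 7.39] -/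
theorem rowNorm_eq_zero_iff_forall : rowNorm M = 0 ↔ ∀ a : Fin 2, M (Sum.inr 0) (Sum.inl a) = 0 := by
  rw [rowNorm_eq_zero_iff]
  constructor
  · rintro ⟨h0, h1⟩ a
    fin_cases a
    · exact h0
    · exact h1
  · intro h
    exact ⟨h 0, h 1⟩

/-- the complex form `(‖r‖ : ℂ)² = r₁ r̄₁ + r₂ r̄₂`. [cite: Knapp2002, VII §3 Thm. 7.39] -/
theorem ofReal_rowNorm_sq :
    ((rowNorm M : ℂ)) ^ 2 = M (Sum.inr 0) (Sum.inl 0) * conj (M (Sum.inr 0) (Sum.inl 0)) +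
      M (Sum.inr 0) (Sum.inl 1) * conj (M (Sum.inr 0) (Sum.inl 1)) := by
  rw [← Complex.ofReal_pow, rowNorm_sq, Complex.mul_conj, Complex.mul_conj, Complex.normSq_eq_norm_sq, Complex.normSq_eq_norm_sq]
  push_cast
  ring

/-- `sinh (secT g) = ‖r‖`. [cite: Knapp2002, VII §3 Thm. 7.39] -/
theorem sinh_secT : Real.sinh (secT M) = rowNorm M := Real.sinh_arsinh _

/-- `cosh (secT g) = √(1 + ‖r‖²)`. [cite: Knapp2002, VII §3 Thm. 7.39] -/
theorem cosh_secT : Real.cosh (secT M) = Real.sqrt (1 + rowNorm M ^ 2) := Real.cosh_arsinh _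

/-- `secT g ≥ 0`. [cite: Knapp2002, VII §3 Thm. 7.39] -/
theorem secT_nonneg : 0 ≤ secT M := Real.arsinh_nonneg_iff.2 (rowNorm_nonneg M)

/-- **`secT g > 0 ↔ ‖r‖ ≠ 0`** (off `K`). [cite: Knapp2002, VII §3 Thm. 7.39] -/
theorem secT_pos_iff : 0 < secT M ↔ rowNorm M ≠ 0 := by
  rw [secT, Real.arsinh_pos_iff]
  exact ⟨fun h => h.ne', fun h => lt_of_le_of_ne (rowNorm_nonneg M) (Ne.symm h)⟩

/-- `secT g = 0 ↔ ‖r‖ = 0`. [cite: Knapp2002, VII §3 Thm. 7.39] -/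
theorem secT_eq_zero_iff : secT M = 0 ↔ rowNorm M = 0 := Real.arsinh_eq_zero_iff

/-- entries of `secU`. [cite: Knapp2002, VII §3 Thm. 7.39] -/
theorem secU_apply_zero_zero : secU M 0 0 = -I * M (Sum.inr 0) (Sum.inl 0) / (rowNorm M : ℂ) := rfl
/-- entries of `secU`. [cite: Knapp2002, VII §3 Thm. 7.39] -/
theorem secU_apply_zero_one : secU M 0 1 = -I * M (Sum.inr 0) (Sum.inl 1) / (rowNorm M : ℂ) := rfl
/-- entries of `secU`. [cite: Knapp2002, VII §3 Thm. 7.39] -/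
theorem secU_apply_one_zero : secU M 1 0 = -conj (M (Sum.inr 0) (Sum.inl 1)) / (rowNorm M : ℂ) := rfl
/-- entries of `secU`. [cite: Knapp2002, VII §3 Thm. 7.39] -/
theorem secU_apply_one_one : secU M 1 1 = conj (M (Sum.inr 0) (Sum.inl 0)) / (rowNorm M : ℂ) := rfl
/-- the entry of `secZ`. [cite: Knapp2002, VII §3 Thm. 7.39] -/
theorem secZ_apply (i j : Fin 1) : secZ M i j = M (Sum.inr 0) (Sum.inr 0) / (‖M (Sum.inr 0) (Sum.inr 0)‖ : ℂ) := by
  fin_cases i; fin_cases j; rfl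

end Basic

/-! ## §3 Unitarity of the blocks and the explicit inverse -/

section Unitary

/-- scalar identity behind `(U Uᴴ)₀₀ = 1`. [cite: Knapp2002, VII §3 Thm. 7.39] -/
private theorem aux₀₀ (r₀ r₁ : ℂ) (ρ : ℝ) (hρ : (ρ : ℂ) ≠ 0) (hρ2 : ((ρ : ℂ)) ^ 2 = r₀ * conj r₀ + r₁ * conj r₁) :
    (-I * r₀ / (ρ : ℂ)) * conj (-I * r₀ / (ρ : ℂ)) + (-I * r₁ / (ρ : ℂ)) * conj (-I * r₁ / (ρ : ℂ)) = 1 := by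
  simp only [map_neg, map_mul, map_div₀, Complex.conj_I, Complex.conj_ofReal, neg_neg]
  field_simp
  linear_combination (norm := ring_nf) -hρ2
  · simp only [Complex.I_sq]; ring

/-- scalar identity behind `(U Uᴴ)₀₁ = 0`. [cite: Knapp2002, VII §3 Thm. 7.39] -/
private theorem aux₀₁ (r₀ r₁ : ℂ) (ρ : ℝ) :
    (-I * r₀ / (ρ : ℂ)) * conj (-conj r₁ / (ρ : ℂ)) + (-I * r₁ / (ρ : ℂ)) * conj (conj r₀ / (ρ : ℂ)) = 0 := by
  simp only [map_neg, map_div₀, Complex.conj_ofReal, Complex.conj_conj]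
  ring

/-- scalar identity behind `(U Uᴴ)₁₀ = 0`. [cite: Knapp2002, VII §3 Thm. 7.39] -/
private theorem aux₁₀ (r₀ r₁ : ℂ) (ρ : ℝ) :
    (-conj r₁ / (ρ : ℂ)) * conj (-I * r₀ / (ρ : ℂ)) + (conj r₀ / (ρ : ℂ)) * conj (-I * r₁ / (ρ : ℂ)) = 0 := by
  simp only [map_neg, map_mul, map_div₀, Complex.conj_I, Complex.conj_ofReal, neg_neg]
  ring

/-- scalar identity behind `(U Uᴴ)₁₁ = 1`. [cite: Knapp2002, VII §3 Thm. 7.39] -/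
private theorem aux₁₁ (r₀ r₁ : ℂ) (ρ : ℝ) (hρ : (ρ : ℂ) ≠ 0) (hρ2 : ((ρ : ℂ)) ^ 2 = r₀ * conj r₀ + r₁ * conj r₁) :
    (-conj r₁ / (ρ : ℂ)) * conj (-conj r₁ / (ρ : ℂ)) + (conj r₀ / (ρ : ℂ)) * conj (conj r₀ / (ρ : ℂ)) = 1 := by
  simp only [map_neg, map_div₀, Complex.conj_ofReal, Complex.conj_conj]
  field_simp
  linear_combination (norm := ring_nf) -hρ2

/-- scalar identity behind `Z Zᴴ = 1`: `(c∕|c|) · conj (c∕|c|) = 1`. [cite: Knapp2002, VII §3 Thm. 7.39] -/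
private theorem auxZ (c : ℂ) (hc : c ≠ 0) : (c / (‖c‖ : ℂ)) * conj (c / (‖c‖ : ℂ)) = 1 := by
  simp only [map_div₀, Complex.conj_ofReal]
  have h : (‖c‖ : ℂ) ≠ 0 := by exact_mod_cast norm_ne_zero_iff.2 hc
  field_simp
  rw [Complex.mul_conj, Complex.normSq_eq_norm_sq]; push_cast; ring

variable (M : Matrix (Fin 2 ⊕ Fin 1) (Fin 2 ⊕ Fin 1) ℂ)

/-- `secU g · (secU g)ᴴ = 1` when `‖r‖ ≠ 0` (rows orthonormal). [cite: Knapp2002, VII §3 Thm. 7.39] -/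
theorem secU_mul_conjTranspose (hr : rowNorm M ≠ 0) : secU M * (secU M)ᴴ = 1 := by
  have hρ : (rowNorm M : ℂ) ≠ 0 := Complex.ofReal_ne_zero.2 hr
  have hρ2 := ofReal_rowNorm_sq M
  ext i j
  fin_cases i <;> fin_cases j
  · rw [Matrix.mul_apply, Fin.sum_univ_two]
    simp only [Fin.zero_eta, Fin.isValue, Matrix.conjTranspose_apply, Complex.star_def, Matrix.one_apply_eq]
    exact aux₀₀ _ _ _ hρ hρ2
  · rw [Matrix.mul_apply, Fin.sum_univ_two]
    simp only [Fin.zero_eta, Fin.isValue, Fin.mk_one, Matrix.conjTranspose_apply, Complex.star_def, ne_eq, zero_ne_one,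
      not_false_eq_true, Matrix.one_apply_ne]
    exact aux₀₁ _ _ _
  · rw [Matrix.mul_apply, Fin.sum_univ_two]
    simp only [Fin.zero_eta, Fin.isValue, Fin.mk_one, Matrix.conjTranspose_apply, Complex.star_def, ne_eq, one_ne_zero,
      not_false_eq_true, Matrix.one_apply_ne]
    exact aux₁₀ _ _ _
  · rw [Matrix.mul_apply, Fin.sum_univ_two]
    simp only [Fin.isValue, Fin.mk_one, Matrix.conjTranspose_apply, Complex.star_def, Matrix.one_apply_eq]
    exact aux₁₁ _ _ _ hρ hρ2

/-- `(secU g)ᴴ · secU g = 1` when `‖r‖ ≠ 0`. [cite: Knapp2002, VII §3 Thm. 7.39] -/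
theorem conjTranspose_mul_secU (hr : rowNorm M ≠ 0) : (secU M)ᴴ * secU M = 1 :=
  mul_eq_one_comm.1 (secU_mul_conjTranspose M hr)

/-- **`secU g ∈ U(2)`** when `‖r‖ ≠ 0`. [cite: Knapp2002, VII §3 Thm. 7.39] -/
theorem secU_mem_unitaryGroup (hr : rowNorm M ≠ 0) : secU M ∈ Matrix.unitaryGroup (Fin 2) ℂ := by
  rw [Matrix.mem_unitaryGroup_iff, Matrix.star_eq_conjTranspose]
  exact secU_mul_conjTranspose M hr

/-- `secZ g · (secZ g)ᴴ = 1` when `g₃₃ ≠ 0`. [cite: Knapp2002, VII §3 Thm. 7.39] -/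
theorem secZ_mul_conjTranspose (hc : M (Sum.inr 0) (Sum.inr 0) ≠ 0) : secZ M * (secZ M)ᴴ = 1 := by
  ext i j
  fin_cases i; fin_cases j
  rw [Matrix.mul_apply, Fintype.sum_subsingleton _ (0 : Fin 1)]
  simp only [Fin.zero_eta, Fin.isValue, Matrix.conjTranspose_apply, Complex.star_def, Matrix.one_apply_eq, secZ_apply]
  exact auxZ _ hc

/-- `(secZ g)ᴴ · secZ g = 1` when `g₃₃ ≠ 0`. [cite: Knapp2002, VII §3 Thm. 7.39] -/
theorem conjTranspose_mul_secZ (hc : M (Sum.inr 0) (Sum.inr 0) ≠ 0) : (secZ M)ᴴ * secZ M = 1 :=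
  mul_eq_one_comm.1 (secZ_mul_conjTranspose M hc)

/-- **`secZ g ∈ U(1)`** when `g₃₃ ≠ 0`. [cite: Knapp2002, VII §3 Thm. 7.39] -/
theorem secZ_mem_unitaryGroup (hc : M (Sum.inr 0) (Sum.inr 0) ≠ 0) : secZ M ∈ Matrix.unitaryGroup (Fin 1) ℂ := by
  rw [Matrix.mem_unitaryGroup_iff, Matrix.star_eq_conjTranspose]
  exact secZ_mul_conjTranspose M hc

/-- **`secK₂ g · secK₂Inv g = 1`** (`‖r‖ ≠ 0`, `g₃₃ ≠ 0`). [cite: Knapp2002, VII §3 Thm. 7.39] -/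
theorem secK₂_mul_secK₂Inv (hr : rowNorm M ≠ 0) (hc : M (Sum.inr 0) (Sum.inr 0) ≠ 0) : secK₂ M * secK₂Inv M = 1 := by
  rw [secK₂, secK₂Inv, Matrix.fromBlocks_multiply, secU_mul_conjTranspose M hr, secZ_mul_conjTranspose M hc]
  simp

/-- **`secK₂Inv g · secK₂ g = 1`** (`‖r‖ ≠ 0`, `g₃₃ ≠ 0`). [cite: Knapp2002, VII §3 Thm. 7.39] -/
theorem secK₂Inv_mul_secK₂ (hr : rowNorm M ≠ 0) (hc : M (Sum.inr 0) (Sum.inr 0) ≠ 0) : secK₂Inv M * secK₂ M = 1 := by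
  rw [secK₂, secK₂Inv, Matrix.fromBlocks_multiply, conjTranspose_mul_secU M hr, conjTranspose_mul_secZ M hc]
  simp

/-- `secK₂Inv g = (secK₂ g)ᴴ`. [cite: Knapp2002, VII §3 Thm. 7.39] -/
theorem secK₂Inv_eq_conjTranspose : secK₂Inv M = (secK₂ M)ᴴ := by
  rw [secK₂, secK₂Inv, Matrix.fromBlocks_conjTranspose]
  simp

end Unitary

/-! ## §4 The last row of `g · k₂⁻¹` and of `k₁` (pure algebra) -/

section LastRow

variable (M : Matrix (Fin 2 ⊕ Fin 1) (Fin 2 ⊕ Fin 1) ℂ)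

/-- `(g k₂⁻¹)₃₁ = i‖r‖`. [cite: Knapp2002, VII §3 Thm. 7.39] -/
theorem mul_secK₂Inv_inr_inl_zero (hr : rowNorm M ≠ 0) :
    (M * secK₂Inv M) (Sum.inr 0) (Sum.inl 0) = I * (rowNorm M : ℂ) := by
  have hρ : (rowNorm M : ℂ) ≠ 0 := Complex.ofReal_ne_zero.2 hr
  have hρ2 := ofReal_rowNorm_sq M
  rw [Matrix.mul_apply, Fintype.sum_sum_type, Fin.sum_univ_two, Fintype.sum_subsingleton _ (0 : Fin 1)]
  simp only [secK₂Inv, Matrix.fromBlocks_apply₁₁, Matrix.fromBlocks_apply₂₁, Matrix.conjTranspose_apply, Matrix.zero_apply,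
    mul_zero, add_zero, secU_apply_zero_zero, secU_apply_zero_one, Complex.star_def, map_neg, map_mul, map_div₀, Complex.conj_I,
    Complex.conj_ofReal, neg_neg]
  field_simp
  linear_combination (norm := ring_nf) -hρ2

/-- `(g k₂⁻¹)₃₂ = 0`. [cite: Knapp2002, VII §3 Thm. 7.39] -/
theorem mul_secK₂Inv_inr_inl_one :
    (M * secK₂Inv M) (Sum.inr 0) (Sum.inl 1) = 0 := by
  rw [Matrix.mul_apply, Fintype.sum_sum_type, Fin.sum_univ_two, Fintype.sum_subsingleton _ (0 : Fin 1)]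
  simp only [secK₂Inv, Matrix.fromBlocks_apply₁₁, Matrix.fromBlocks_apply₂₁, Matrix.conjTranspose_apply, Matrix.zero_apply,
    mul_zero, add_zero, secU_apply_one_zero, secU_apply_one_one, Complex.star_def, map_neg, map_div₀,
    Complex.conj_ofReal, Complex.conj_conj]
  ring

/-- `(g k₂⁻¹)₃₃ = |g₃₃|`. [cite: Knapp2002, VII §3 Thm. 7.39] -/
theorem mul_secK₂Inv_inr_inr (hc : M (Sum.inr 0) (Sum.inr 0) ≠ 0) :
    (M * secK₂Inv M) (Sum.inr 0) (Sum.inr 0) = (‖M (Sum.inr 0) (Sum.inr 0)‖ : ℂ) := by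
  have h : (‖M (Sum.inr 0) (Sum.inr 0)‖ : ℂ) ≠ 0 := by exact_mod_cast norm_ne_zero_iff.2 hc
  rw [Matrix.mul_apply, Fintype.sum_sum_type, Fin.sum_univ_two, Fintype.sum_subsingleton _ (0 : Fin 1)]
  simp only [secK₂Inv, Matrix.fromBlocks_apply₁₂, Matrix.fromBlocks_apply₂₂, Matrix.conjTranspose_apply, Matrix.zero_apply,
    mul_zero, zero_add, secZ_apply, Complex.star_def, map_div₀, Complex.conj_ofReal]
  field_simp
  rw [Complex.mul_conj, Complex.normSq_eq_norm_sq]; push_cast; ring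

/-- entries of the boost `a_{−T}` in the frame `(p₀, q₀) = (0, 0)`: `(a_{-T})_{inl 0, inl 0} = cosh T`. [cite: Knapp2002, I §10 Prop. 1.87] -/
theorem hypV_neg_inl_zero_inl_zero (T : ℝ) :
    (((hypV (0 : Fin 2) (0 : Fin 1) (-T) : UForm (Fin 2) (Fin 1)) : GL (Fin 2 ⊕ Fin 1) ℂ) : Matrix (Fin 2 ⊕ Fin 1) (Fin 2 ⊕ Fin 1) ℂ)
        (Sum.inl 0) (Sum.inl 0) = (Real.cosh T : ℂ) := by
  rw [hypV_inl_inl]; simp [Real.cosh_neg]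

/-- **the last row of `k₁ = g k₂⁻¹ a_{−secT g}`**, generic form: if the last row of `g k₂⁻¹` is `(i sinh T, 0, cosh T)` with `T = secT g`
then the last row of `k₁` is `(0, 0, 1)`.  Here: the `inl 0` entry. [cite: Knapp2002, VII §3 Thm. 7.39] -/
theorem secK₁_apply_inr_inl_zero_of (hr : rowNorm M ≠ 0)
    (hc : (‖M (Sum.inr 0) (Sum.inr 0)‖ : ℝ) = Real.cosh (secT M)) (hc0 : M (Sum.inr 0) (Sum.inr 0) ≠ 0) :
    secK₁ M (Sum.inr 0) (Sum.inl 0) = 0 := by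
  rw [secK₁, Matrix.mul_apply, Fintype.sum_sum_type, Fin.sum_univ_two, Fintype.sum_subsingleton _ (0 : Fin 1),
    mul_secK₂Inv_inr_inl_zero M hr, mul_secK₂Inv_inr_inl_one M, mul_secK₂Inv_inr_inr M hc0, hc,
    hypV_inl_inl, hypV_inl_inl, hypV_inr_inl, ← sinh_secT M]
  simp only [if_true, true_and, one_ne_zero, if_false, zero_mul, add_zero, Real.sinh_neg, Real.cosh_neg,
    Complex.ofReal_neg]
  ring

/-- the `inl 1` entry of the last row of `k₁` vanishes. [cite: Knapp2002, VII §3 Thm. 7.39] -/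
theorem secK₁_apply_inr_inl_one (hr : rowNorm M ≠ 0) (hc0 : M (Sum.inr 0) (Sum.inr 0) ≠ 0) :
    secK₁ M (Sum.inr 0) (Sum.inl 1) = 0 := by
  rw [secK₁, Matrix.mul_apply, Fintype.sum_sum_type, Fin.sum_univ_two, Fintype.sum_subsingleton _ (0 : Fin 1),
    mul_secK₂Inv_inr_inl_zero M hr, mul_secK₂Inv_inr_inl_one M, mul_secK₂Inv_inr_inr M hc0,
    hypV_inl_inl, hypV_inl_inl, hypV_inr_inl]
  simp

/-- the corner entry of `k₁` is `1` when `|g₃₃| = cosh (secT g)`. [cite: Knapp2002, VII §3 Thm. 7.39] -/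
theorem secK₁_apply_inr_inr_of (hr : rowNorm M ≠ 0)
    (hc : (‖M (Sum.inr 0) (Sum.inr 0)‖ : ℝ) = Real.cosh (secT M)) (hc0 : M (Sum.inr 0) (Sum.inr 0) ≠ 0) :
    secK₁ M (Sum.inr 0) (Sum.inr 0) = 1 := by
  rw [secK₁, Matrix.mul_apply, Fintype.sum_sum_type, Fin.sum_univ_two, Fintype.sum_subsingleton _ (0 : Fin 1),
    mul_secK₂Inv_inr_inl_zero M hr, mul_secK₂Inv_inr_inl_one M, mul_secK₂Inv_inr_inr M hc0, hc,
    hypV_inl_inr, hypV_inl_inr, hypV_inr_inr, ← sinh_secT M]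
  simp only [if_true, and_true, one_ne_zero, if_false, zero_mul, add_zero, Real.sinh_neg, Real.cosh_neg,
    Complex.ofReal_neg]
  have h := Real.cosh_sq (secT M)
  have h' : ((Real.cosh (secT M) : ℂ)) ^ 2 = (Real.sinh (secT M) : ℂ) ^ 2 + 1 := by exact_mod_cast h
  linear_combination (norm := ring_nf) h'
  · simp only [Complex.I_sq]; ring

/-- **the section identity** `secK₁ g · a_{secT g} · secK₂ g = g` (pure algebra: `a_{−T} a_T = 1` and `k₂⁻¹ k₂ = 1`).
[cite: Knapp2002, VII §3 Thm. 7.39] -/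
theorem secK₁_mul_hypV_mul_secK₂ (hr : rowNorm M ≠ 0) (hc : M (Sum.inr 0) (Sum.inr 0) ≠ 0) :
    secK₁ M * (((hypV (0 : Fin 2) (0 : Fin 1) (secT M) : UForm (Fin 2) (Fin 1)) : GL (Fin 2 ⊕ Fin 1) ℂ) :
      Matrix (Fin 2 ⊕ Fin 1) (Fin 2 ⊕ Fin 1) ℂ) * secK₂ M = M := by
  have h1 : (((hypV (0 : Fin 2) (0 : Fin 1) (-secT M) : UForm (Fin 2) (Fin 1)) : GL (Fin 2 ⊕ Fin 1) ℂ) :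
        Matrix (Fin 2 ⊕ Fin 1) (Fin 2 ⊕ Fin 1) ℂ) *
      (((hypV (0 : Fin 2) (0 : Fin 1) (secT M) : UForm (Fin 2) (Fin 1)) : GL (Fin 2 ⊕ Fin 1) ℂ) :
        Matrix (Fin 2 ⊕ Fin 1) (Fin 2 ⊕ Fin 1) ℂ) = 1 := by
    rw [← UForm.coe_mul, ← hypV_add, neg_add_cancel, hypV_zero, UForm.coe_one]
  rw [secK₁, Matrix.mul_assoc (M * secK₂Inv M), h1, Matrix.mul_one, Matrix.mul_assoc, secK₂Inv_mul_secK₂ M hr hc,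
    Matrix.mul_one]

end LastRow

end RealDualPair

end Literature.RepresentationTheory.KonnoKonno2007

end
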